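import Summits.HubbardSuperconductivity.HubbardSuperconductivity.Theses.LogColdTorus
import Summits.HubbardSuperconductivity.HubbardSuperconductivity.Theorems.LogColdTorusLogColdDWaveOrderStiffnessCeiling
import Literature.MathematicalPhysics.QuantumLattice.HubbardTorusFlux
import HarnessLib

/-!
# Route `LogColdTorus`, crux `LogColdDWaveOrder` (stmt-HubbardSuperconductivity-8807), line `registered`:
# the stiffness-to-order stub (S2) is modus ponens through the stiffness predicate

Support file for the registered skeleton `Cruxes/LogColdDWaveOrder/Lines/birth.lean`
(stubs `stub_logColdStiffness` = S1, `stub_stiffnessToOrderAtThreshold` = S2, glue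
`LogColdDWaveOrder_of`). Everything is stated inline (no definition is introduced); "the body of S1
at data `(δ, U₁, U₂, κ₀, ρ)`" is the log-cold flux-stiffness predicate
`∀ κ ≥ κ₀, ∃ L₀, ∀ U ∈ (U₁,U₂), ∀ even L ≥ L₀, ∀ |θ| ≤ π/2:
Re Z_{κ log L}((hubbardTorusFlux L U θ)|_sec) ≤ e^{-ρθ²κ log L} · Re Z_{κ log L}((hubbardTorus 2 L 1 U)|_sec)`
on the `(N_L, S^z = 0)` coordinate sector, and "the body of the crux at data `(δ, U₁, U₂, κ₀, c)`" is
`∀ κ ≥ κ₀, ∃ L₀, ∀ U ∈ (U₁,U₂), ∀ even L ≥ L₀: c·L⁴ ≤ Re ω^{sec}_{κ log L, L}(Δ_d†Δ_d)`.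

* `stiffnessToOrderAtThreshold_iff_modusPonens` — **formal status of S2.** The registered signature of
  `stub_stiffnessToOrderAtThreshold` (for all data `δ ∈ (0,1/4)`, `0 < U₁ < U₂`, `κ₀, ρ > 0`: body of
  S1 ⇒ `∃ A B > 0, ∀ κ ≥ κ₀, …, A·e^{-B/(κρ)}·L⁴ ≤ Re ω^{sec}_{κ log L, L}(Δ_d†Δ_d)`) is EQUIVALENT to
  plain modus ponens through the stiffness predicate: for all data, body of S1 ⇒ body of the crux at
  the same `(δ, U₁, U₂, κ₀)` for some `c > 0`. The "threshold scaling law" constants `A e^{-B/(κρ)}`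
  are decorative: (→) `c := A e^{-B/(κ₀ρ)}`, valid for all `κ ≥ κ₀` by monotonicity in `κ`;
  (←) `A := c`, `B := 1`, using `e^{-1/(κρ)} ≤ 1`. So S2 is exactly "log-cold stiffness ⇒ log-cold
  `d_{x²-y²}` order" for interacting fermions at EVERY datum — the XY / pairing-symmetry step, for
  which no theorem exists (not even for the plane rotator: the proved calibrations of the route get
  order from infrared bounds, not from stiffness).
* `stiffnessToOrder_modusPonens_iff_le_two` — by the landed ceiling `logColdStiffness_le_two`
  (S1-body ⇒ `ρ ≤ 2`, thermal Bloch bound), the modus-ponens form need only be established for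
  stiffnesses `0 < ρ ≤ 2`; larger `ρ` are vacuous.
* `logColdDWaveOrder_of_modusPonens` — the crux `LogColdDWaveOrder` BY NAME from the signature of S1
  and the modus-ponens form (`δ < 1/4 < 1/2`).

All [folklore]; sources of the physics reading: Scalapino–White–Zhang, PRB 47 (1993) 7995;
Bramwell–Holdsworth, J. Phys.: Condens. Matter 5 (1993) L53.
-/

-- the mandated namespace `Summit.<Summit>.<Problem>.Theorems` repeats `HubbardSuperconductivity`
-- (single-problem summit, D-0017), which the `dupNamespace` linter flags on every declaration
set_option linter.dupNamespace false

noncomputable section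

namespace Summit.HubbardSuperconductivity.HubbardSuperconductivity.Theorems.LogColdTorus

open Literature.MathematicalPhysics.QuantumLattice Literature.Probability.LatticeModels
-- `Classical` as in the route file and the skeleton: the sector index type `{s // p s}` of
-- `Matrix.toBlock p p` gets its `Fintype`/`DecidableEq` instances from `Classical.propDecidable`
open scoped Matrix ComplexConjugate Classical

/-! ### S2 ⇔ modus ponens through the stiffness predicate -/

/-- **Formal status of the stub `stub_stiffnessToOrderAtThreshold` (S2) of the registered skeleton of
crux `LogColdDWaveOrder`.** Its signature — for all `δ ∈ (0,1/4)`, `0 < U₁ < U₂`, `κ₀ > 0`, `ρ > 0`,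
the log-cold flux stiffness `Re Z_{κ log L}((hubbardTorusFlux L U θ)|_sec) ≤ e^{-ρθ²κ log L} ·
Re Z_{κ log L}((hubbardTorus 2 L 1 U)|_sec)` (`|θ| ≤ π/2`, every `κ ≥ κ₀`, eventually in even `L`,
uniformly on the window, `(N_L, S^z = 0)` sector) implies the threshold scaling law
`A·e^{-B/(κρ)}·L⁴ ≤ Re ω^{sec}_{κ log L, L}(Δ_d†Δ_d)` for some `A, B > 0` — is equivalent to modus
ponens through the stiffness predicate: for all such data, the stiffness body implies the body of
the crux, `∃ c > 0, ∀ κ ≥ κ₀, ∃ L₀, ∀ U ∈ (U₁,U₂), ∀ even L ≥ L₀, c·L⁴ ≤ Re ω^{sec}_{κ log L, L}(Δ_d†Δ_d)`.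
(→) `c := A·e^{-B/(κ₀ρ)}` and `e^{-B/(κ₀ρ)} ≤ e^{-B/(κρ)}` for `κ ≥ κ₀ > 0`, `ρ > 0`;
(←) `A := c`, `B := 1` and `e^{-1/(κρ)} ≤ 1`. [folklore] -/
theorem stiffnessToOrderAtThreshold_iff_modusPonens :
    (∀ δ ∈ Set.Ioo (0:ℝ) (1/4), ∀ (U₁ U₂ κ₀ ρ : ℝ), 0 < U₁ → U₁ < U₂ → 0 < κ₀ → 0 < ρ →
      (∀ κ : ℝ, κ₀ ≤ κ → ∃ L₀ : ℕ, ∀ U ∈ Set.Ioo U₁ U₂, ∀ (L : ℕ) [NeZero L], L₀ ≤ L → Even L →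
        ∀ θ : ℝ, |θ| ≤ Real.pi / 2 →
          let p : Finset (Orb (FermionTorus 2 L)) → Prop := fun s =>
            s.card = 2 * ⌊(1 - δ) * (L : ℝ) ^ 2 / 2⌋₊ ∧
              2 * (s.filter fun i => (ofLex i).2 = 0).card = 2 * ⌊(1 - δ) * (L : ℝ) ^ 2 / 2⌋₊;
          (Matrix.partitionFn (κ * Real.log L) ((hubbardTorusFlux L U θ).toBlock p p)).re ≤
            Real.exp (-(ρ * θ ^ 2 * (κ * Real.log L))) *
              (Matrix.partitionFn (κ * Real.log L) ((hubbardTorus 2 L 1 U).toBlock p p)).re) →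
      ∃ A B : ℝ, 0 < A ∧ 0 < B ∧
        ∀ κ : ℝ, κ₀ ≤ κ → ∃ L₀ : ℕ, ∀ U ∈ Set.Ioo U₁ U₂, ∀ (L : ℕ) [NeZero L], L₀ ≤ L → Even L →
          let p : Finset (Orb (FermionTorus 2 L)) → Prop := fun s =>
            s.card = 2 * ⌊(1 - δ) * (L : ℝ) ^ 2 / 2⌋₊ ∧
              2 * (s.filter fun i => (ofLex i).2 = 0).card = 2 * ⌊(1 - δ) * (L : ℝ) ^ 2 / 2⌋₊;
          A * Real.exp (-(B / (κ * ρ))) * (L : ℝ) ^ 4 ≤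
            (Matrix.gibbsState (κ * Real.log L) ((hubbardTorus 2 L 1 U).toBlock p p)
              (((pairField dWaveFormFactor L)ᴴ * pairField dWaveFormFactor L).toBlock p p)).re) ↔
    (∀ δ ∈ Set.Ioo (0:ℝ) (1/4), ∀ (U₁ U₂ κ₀ ρ : ℝ), 0 < U₁ → U₁ < U₂ → 0 < κ₀ → 0 < ρ →
      (∀ κ : ℝ, κ₀ ≤ κ → ∃ L₀ : ℕ, ∀ U ∈ Set.Ioo U₁ U₂, ∀ (L : ℕ) [NeZero L], L₀ ≤ L → Even L →
        ∀ θ : ℝ, |θ| ≤ Real.pi / 2 →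
          let p : Finset (Orb (FermionTorus 2 L)) → Prop := fun s =>
            s.card = 2 * ⌊(1 - δ) * (L : ℝ) ^ 2 / 2⌋₊ ∧
              2 * (s.filter fun i => (ofLex i).2 = 0).card = 2 * ⌊(1 - δ) * (L : ℝ) ^ 2 / 2⌋₊;
          (Matrix.partitionFn (κ * Real.log L) ((hubbardTorusFlux L U θ).toBlock p p)).re ≤
            Real.exp (-(ρ * θ ^ 2 * (κ * Real.log L))) *
              (Matrix.partitionFn (κ * Real.log L) ((hubbardTorus 2 L 1 U).toBlock p p)).re) →
      ∃ c : ℝ, 0 < c ∧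
        ∀ κ : ℝ, κ₀ ≤ κ → ∃ L₀ : ℕ, ∀ U ∈ Set.Ioo U₁ U₂, ∀ (L : ℕ) [NeZero L], L₀ ≤ L → Even L →
          let p : Finset (Orb (FermionTorus 2 L)) → Prop := fun s =>
            s.card = 2 * ⌊(1 - δ) * (L : ℝ) ^ 2 / 2⌋₊ ∧
              2 * (s.filter fun i => (ofLex i).2 = 0).card = 2 * ⌊(1 - δ) * (L : ℝ) ^ 2 / 2⌋₊;
          c * (L : ℝ) ^ 4 ≤
            (Matrix.gibbsState (κ * Real.log L) ((hubbardTorus 2 L 1 U).toBlock p p)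
              (((pairField dWaveFormFactor L)ᴴ * pairField dWaveFormFactor L).toBlock p p)).re) := by
  constructor
  · -- (→): fix the uniform constant `c := A · e^{-B/(κ₀ρ)}`, monotone in `κ`
    intro h δ hδ U₁ U₂ κ₀ ρ hU₁ hU₁₂ hκ₀ hρ hstiff
    obtain ⟨A, B, hA, hB, horder⟩ := h δ hδ U₁ U₂ κ₀ ρ hU₁ hU₁₂ hκ₀ hρ hstiff
    refine ⟨A * Real.exp (-(B / (κ₀ * ρ))), by positivity, ?_⟩
    intro κ hκ
    obtain ⟨L₀, hL₀⟩ := horder κ hκ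
    refine ⟨L₀, ?_⟩
    intro U hU L _ hL hEven
    have h := hL₀ U hU L hL hEven
    have hκρ : κ₀ * ρ ≤ κ * ρ := mul_le_mul_of_nonneg_right hκ hρ.le
    have hκ₀ρ : 0 < κ₀ * ρ := mul_pos hκ₀ hρ
    have hdiv : B / (κ * ρ) ≤ B / (κ₀ * ρ) := div_le_div_of_nonneg_left hB.le hκ₀ρ hκρ
    have hmono : A * Real.exp (-(B / (κ₀ * ρ))) ≤ A * Real.exp (-(B / (κ * ρ))) :=
      mul_le_mul_of_nonneg_left (Real.exp_le_exp.mpr (neg_le_neg hdiv)) hA.le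
    have hL4 : (0:ℝ) ≤ (L : ℝ) ^ 4 := by positivity
    exact le_trans (mul_le_mul_of_nonneg_right hmono hL4) h
  · -- (←): `A := c`, `B := 1`, and `e^{-1/(κρ)} ≤ 1`
    intro h δ hδ U₁ U₂ κ₀ ρ hU₁ hU₁₂ hκ₀ hρ hstiff
    obtain ⟨c, hc, horder⟩ := h δ hδ U₁ U₂ κ₀ ρ hU₁ hU₁₂ hκ₀ hρ hstiff
    refine ⟨c, 1, hc, one_pos, ?_⟩
    intro κ hκ
    obtain ⟨L₀, hL₀⟩ := horder κ hκ
    refine ⟨L₀, ?_⟩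
    intro U hU L _ hL hEven
    have h := hL₀ U hU L hL hEven
    have hκρ : 0 < κ * ρ := mul_pos (hκ₀.trans_le hκ) hρ
    have hexp : Real.exp (-(1 / (κ * ρ))) ≤ 1 :=
      Real.exp_le_one_iff.mpr (neg_nonpos.mpr (by positivity))
    have hmono : c * Real.exp (-(1 / (κ * ρ))) ≤ c := by
      simpa only [mul_one] using mul_le_mul_of_nonneg_left hexp hc.le
    have hL4 : (0:ℝ) ≤ (L : ℝ) ^ 4 := by positivity
    exact le_trans (mul_le_mul_of_nonneg_right hmono hL4) h

/-- **The modus-ponens form of S2 need only be established for stiffnesses `ρ ≤ 2`.** By the ceiling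
`logColdStiffness_le_two` (the body of S1 at data `(δ, U₁, U₂, κ₀, ρ)` forces `ρ ≤ 2`, thermal Bloch
bound), "for all data, S1-body ⇒ crux-body" is equivalent to the same implication restricted to
`ρ ≤ 2`: data with `ρ > 2` never realise the stiffness body. [folklore] -/
theorem stiffnessToOrder_modusPonens_iff_le_two :
    (∀ δ ∈ Set.Ioo (0:ℝ) (1/4), ∀ (U₁ U₂ κ₀ ρ : ℝ), 0 < U₁ → U₁ < U₂ → 0 < κ₀ → 0 < ρ →
      (∀ κ : ℝ, κ₀ ≤ κ → ∃ L₀ : ℕ, ∀ U ∈ Set.Ioo U₁ U₂, ∀ (L : ℕ) [NeZero L], L₀ ≤ L → Even L →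
        ∀ θ : ℝ, |θ| ≤ Real.pi / 2 →
          let p : Finset (Orb (FermionTorus 2 L)) → Prop := fun s =>
            s.card = 2 * ⌊(1 - δ) * (L : ℝ) ^ 2 / 2⌋₊ ∧
              2 * (s.filter fun i => (ofLex i).2 = 0).card = 2 * ⌊(1 - δ) * (L : ℝ) ^ 2 / 2⌋₊;
          (Matrix.partitionFn (κ * Real.log L) ((hubbardTorusFlux L U θ).toBlock p p)).re ≤
            Real.exp (-(ρ * θ ^ 2 * (κ * Real.log L))) *
              (Matrix.partitionFn (κ * Real.log L) ((hubbardTorus 2 L 1 U).toBlock p p)).re) →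
      ∃ c : ℝ, 0 < c ∧
        ∀ κ : ℝ, κ₀ ≤ κ → ∃ L₀ : ℕ, ∀ U ∈ Set.Ioo U₁ U₂, ∀ (L : ℕ) [NeZero L], L₀ ≤ L → Even L →
          let p : Finset (Orb (FermionTorus 2 L)) → Prop := fun s =>
            s.card = 2 * ⌊(1 - δ) * (L : ℝ) ^ 2 / 2⌋₊ ∧
              2 * (s.filter fun i => (ofLex i).2 = 0).card = 2 * ⌊(1 - δ) * (L : ℝ) ^ 2 / 2⌋₊;
          c * (L : ℝ) ^ 4 ≤
            (Matrix.gibbsState (κ * Real.log L) ((hubbardTorus 2 L 1 U).toBlock p p)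
              (((pairField dWaveFormFactor L)ᴴ * pairField dWaveFormFactor L).toBlock p p)).re) ↔
    (∀ δ ∈ Set.Ioo (0:ℝ) (1/4), ∀ (U₁ U₂ κ₀ ρ : ℝ), 0 < U₁ → U₁ < U₂ → 0 < κ₀ → 0 < ρ → ρ ≤ 2 →
      (∀ κ : ℝ, κ₀ ≤ κ → ∃ L₀ : ℕ, ∀ U ∈ Set.Ioo U₁ U₂, ∀ (L : ℕ) [NeZero L], L₀ ≤ L → Even L →
        ∀ θ : ℝ, |θ| ≤ Real.pi / 2 →
          let p : Finset (Orb (FermionTorus 2 L)) → Prop := fun s =>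
            s.card = 2 * ⌊(1 - δ) * (L : ℝ) ^ 2 / 2⌋₊ ∧
              2 * (s.filter fun i => (ofLex i).2 = 0).card = 2 * ⌊(1 - δ) * (L : ℝ) ^ 2 / 2⌋₊;
          (Matrix.partitionFn (κ * Real.log L) ((hubbardTorusFlux L U θ).toBlock p p)).re ≤
            Real.exp (-(ρ * θ ^ 2 * (κ * Real.log L))) *
              (Matrix.partitionFn (κ * Real.log L) ((hubbardTorus 2 L 1 U).toBlock p p)).re) →
      ∃ c : ℝ, 0 < c ∧
        ∀ κ : ℝ, κ₀ ≤ κ → ∃ L₀ : ℕ, ∀ U ∈ Set.Ioo U₁ U₂, ∀ (L : ℕ) [NeZero L], L₀ ≤ L → Even L →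
          let p : Finset (Orb (FermionTorus 2 L)) → Prop := fun s =>
            s.card = 2 * ⌊(1 - δ) * (L : ℝ) ^ 2 / 2⌋₊ ∧
              2 * (s.filter fun i => (ofLex i).2 = 0).card = 2 * ⌊(1 - δ) * (L : ℝ) ^ 2 / 2⌋₊;
          c * (L : ℝ) ^ 4 ≤
            (Matrix.gibbsState (κ * Real.log L) ((hubbardTorus 2 L 1 U).toBlock p p)
              (((pairField dWaveFormFactor L)ᴴ * pairField dWaveFormFactor L).toBlock p p)).re) := by
  constructor
  · intro h δ hδ U₁ U₂ κ₀ ρ hU₁ hU₁₂ hκ₀ hρ _hρ2 hstiff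
    exact h δ hδ U₁ U₂ κ₀ ρ hU₁ hU₁₂ hκ₀ hρ hstiff
  · intro h δ hδ U₁ U₂ κ₀ ρ hU₁ hU₁₂ hκ₀ hρ hstiff
    exact h δ hδ U₁ U₂ κ₀ ρ hU₁ hU₁₂ hκ₀ hρ
      (logColdStiffness_le_two δ hδ U₁ U₂ κ₀ ρ hU₁ hU₁₂ hκ₀ hρ hstiff) hstiff

/-! ### The crux by name from S1 and the modus-ponens form -/

/-- **`LogColdDWaveOrder` from the signature of `stub_logColdStiffness` (S1) and the modus-ponens
form of S2**: take the data `(δ, U₁, U₂, κ₀, ρ)` and the stiffness body from S1, apply modus ponens to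
get the order constant `c > 0` and the crux body at the same data, and widen `δ < 1/4` to `δ < 1/2`.
Together with `stiffnessToOrderAtThreshold_iff_modusPonens` this is the glue `LogColdDWaveOrder_of`
of the registered skeleton with the decorative constants removed. [folklore] -/
theorem logColdDWaveOrder_of_modusPonens :
    (∃ δ ∈ Set.Ioo (0:ℝ) (1/4), ∃ U₁ U₂ : ℝ, 0 < U₁ ∧ U₁ < U₂ ∧ ∃ κ₀ ρ : ℝ, 0 < κ₀ ∧ 0 < ρ ∧
      ∀ κ : ℝ, κ₀ ≤ κ → ∃ L₀ : ℕ, ∀ U ∈ Set.Ioo U₁ U₂, ∀ (L : ℕ) [NeZero L], L₀ ≤ L → Even L →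
        ∀ θ : ℝ, |θ| ≤ Real.pi / 2 →
          let p : Finset (Orb (FermionTorus 2 L)) → Prop := fun s =>
            s.card = 2 * ⌊(1 - δ) * (L : ℝ) ^ 2 / 2⌋₊ ∧
              2 * (s.filter fun i => (ofLex i).2 = 0).card = 2 * ⌊(1 - δ) * (L : ℝ) ^ 2 / 2⌋₊;
          (Matrix.partitionFn (κ * Real.log L) ((hubbardTorusFlux L U θ).toBlock p p)).re ≤
            Real.exp (-(ρ * θ ^ 2 * (κ * Real.log L))) *
              (Matrix.partitionFn (κ * Real.log L) ((hubbardTorus 2 L 1 U).toBlock p p)).re) →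
    (∀ δ ∈ Set.Ioo (0:ℝ) (1/4), ∀ (U₁ U₂ κ₀ ρ : ℝ), 0 < U₁ → U₁ < U₂ → 0 < κ₀ → 0 < ρ →
      (∀ κ : ℝ, κ₀ ≤ κ → ∃ L₀ : ℕ, ∀ U ∈ Set.Ioo U₁ U₂, ∀ (L : ℕ) [NeZero L], L₀ ≤ L → Even L →
        ∀ θ : ℝ, |θ| ≤ Real.pi / 2 →
          let p : Finset (Orb (FermionTorus 2 L)) → Prop := fun s =>
            s.card = 2 * ⌊(1 - δ) * (L : ℝ) ^ 2 / 2⌋₊ ∧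
              2 * (s.filter fun i => (ofLex i).2 = 0).card = 2 * ⌊(1 - δ) * (L : ℝ) ^ 2 / 2⌋₊;
          (Matrix.partitionFn (κ * Real.log L) ((hubbardTorusFlux L U θ).toBlock p p)).re ≤
            Real.exp (-(ρ * θ ^ 2 * (κ * Real.log L))) *
              (Matrix.partitionFn (κ * Real.log L) ((hubbardTorus 2 L 1 U).toBlock p p)).re) →
      ∃ c : ℝ, 0 < c ∧
        ∀ κ : ℝ, κ₀ ≤ κ → ∃ L₀ : ℕ, ∀ U ∈ Set.Ioo U₁ U₂, ∀ (L : ℕ) [NeZero L], L₀ ≤ L → Even L →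
          let p : Finset (Orb (FermionTorus 2 L)) → Prop := fun s =>
            s.card = 2 * ⌊(1 - δ) * (L : ℝ) ^ 2 / 2⌋₊ ∧
              2 * (s.filter fun i => (ofLex i).2 = 0).card = 2 * ⌊(1 - δ) * (L : ℝ) ^ 2 / 2⌋₊;
          c * (L : ℝ) ^ 4 ≤
            (Matrix.gibbsState (κ * Real.log L) ((hubbardTorus 2 L 1 U).toBlock p p)
              (((pairField dWaveFormFactor L)ᴴ * pairField dWaveFormFactor L).toBlock p p)).re) →
    Summit.HubbardSuperconductivity.HubbardSuperconductivity.Theses.LogColdTorus.LogColdDWaveOrder := by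
  intro h1 h2
  obtain ⟨δ, hδ, U₁, U₂, hU₁, hU₁₂, κ₀, ρ, hκ₀, hρ, hstiff⟩ := h1
  obtain ⟨c, hc, horder⟩ := h2 δ hδ U₁ U₂ κ₀ ρ hU₁ hU₁₂ hκ₀ hρ hstiff
  have hδ' : δ ∈ Set.Ioo (0:ℝ) (1/2) := ⟨hδ.1, hδ.2.trans (by norm_num)⟩
  exact ⟨δ, hδ', U₁, U₂, hU₁, hU₁₂, κ₀, c, hκ₀, hc, horder⟩

end Summit.HubbardSuperconductivity.HubbardSuperconductivity.Theorems.LogColdTorus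

end
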